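import Summits.AnomalousDissipation.AnomalousDissipation.Statement
import Literature.Analysis.FluidPDE.TorusClassicalLerayHopfProofs
import Literature.Analysis.FluidPDE.GalerkinEnergyBalanceLongTime
import Literature.Analysis.FluidPDE.LinearizedNSTorus
import Literature.Analysis.FunctionSpaces.TorusFourierModes
import Literature.Analysis.FunctionSpaces.TorusWeightedGalerkinCoefficients
import Literature.Analysis.FunctionSpaces.TorusCalculusProofs
import Literature.Analysis.FunctionSpaces.TorusSpaceTime

/-!
# Drifted Kolmogorov states: bounded energy with vanishing dissipation (solo soloist, blind mode)

`SoloBlindDriftStates` — an explicit family separating the two quantitative clauses of the summit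
`AnomalousDissipation` (= `Literature.Turb.ZerothLaw`). This file constructs the force and the
states; the steady-state property, energies, dissipation, work and the separating Leray–Hopf family
are in `SoloBlindDriftScreening`.

**The observation.** The summit asks for a mean-zero force but puts NO mean-zero (zero-momentum)
condition on the Leray–Hopf solutions (the tree's `IsWeakNSSolutionOn` deliberately omits it). With
a spatially fixed force Galilean invariance is broken, so the conserved momentum `m = ∫ u` is a
genuine parameter of the problem: a solution of mean `m` is a zero-mean solution driven by the
travelling force `f(x - m t)`, and a fast drift DETUNES the resonance between a steady force and
the flow it drives (sweeping decorrelation).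

**The family.** For the Kolmogorov force `f(x) = cos(2π x₃) e₁` (`kolForce`, modes `±e₃`) and any
drift speed `c`, the field
`U_{ν,c}(x) = c e₃ + Re Σ_{k = ±e₃} e_k(x) σ_{ν,c}(k)⁻¹ ½e₁`, `σ_{ν,c}(k) = 4π²ν + 2πi c k₃`
(`driftState`; in real form `U = c e₃ + (4π²ν cos 2πx₃ + 2πc sin 2πx₃) e₁ / (16π⁴ν² + 4π²c²)`)
is a smooth STEADY solution of the Navier–Stokes system with viscosity `ν` forced by `f`
(`isSteadyNSState_driftState`: `(U·∇)U = c ∂₃U`, and `c ∂₃ - νΔ` acts on the modes `±e₃` as the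
multiplier `σ`), hence a global Leray–Hopf solution from its own value. Its energy and dissipation
are explicit (`integral_norm_sq_driftState`, `dissipation_driftState`):
`∫‖U‖² = c² + ½ / (16π⁴ν² + 4π²c²)`, `ν‖∇U‖₂² = 4π²ν · ½ / (16π⁴ν² + 4π²c²)`.
With `c = 1` and `νⱼ = 1/(j+1)`: energies `≤ 2` uniformly in `j` while the dissipation is
`≤ νⱼ/2 → 0`
(`exists_boundedEnergy_vanishingDissipation`), and the momentum is `∫U = e₃ ≠ 0`
(`integral_driftState`). The work done by the force, `∫⟪f, U_{ν,c}⟫ = 4π²ν · ½ / (16π⁴ν² + 4π²c²)`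
(`integral_inner_kolForce_driftState`), equals the dissipation and vanishes as `ν → 0`; the
family is defined down to `ν = 0`, where `U_{0,c} = c e₃ + sin(2πx₃) e₁ / (2πc)` (`c ≠ 0`) is a
smooth steady solution of the forced EULER system doing no work against the force
(`isSteadyNSState_driftState` with `ν = 0`, `integral_inner_kolForce_driftState_zero`): a
non-trivial steady force exactly balanced by inertia, with zero energy input.

**What it shows about the summit.** (i) Every hypothesis of `ZerothLaw` except the dissipation
floor — fixed smooth divergence-free mean-zero non-zero force, `νⱼ → 0`, global Leray–Hopf
solutions, energies bounded uniformly in `j` — is satisfied by an explicit laminar family whose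
dissipation VANISHES in the limit: bounded energy alone forces nothing, and the uniform energy
bound, which fails for the zero-momentum laminar states `f/(4π²ν)` (energy `~ ν⁻²`), is restored
by drift. (ii) Consequently any mechanism producing the dissipation floor must control the
momentum leaf: for this force the floor is equivalent to an `O(1)` lower bound on the correlation
`⟨u₁ cos 2πx₃⟩`, and the drifted states make that correlation `O(ν)`. (iii) In the zero-momentum
leaf (`∫u = 0`, the convention of Doering–Foias 2002 §2) the corresponding existence question —
bounded energy uniformly in `ν` for a fixed force — is untouched by this construction.
[cite: Frisch1995, §5.2] [cite: DoeringFoias2002, §2]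
-/

open MeasureTheory Filter Topology Set UnitAddTorus
open scoped ENNReal NNReal ComplexConjugate InnerProductSpace

noncomputable section

namespace Summit.AnomalousDissipation.AnomalousDissipation.Theorems

open Literature.Analysis.FunctionSpaces Literature.Analysis.FunctionSpaces.Torus
open Literature.Analysis.FluidPDE

/-! ### The modes `0, ±e₃` -/

/-- The Kolmogorov wave vector `e₃ = (0, 0, 1) ∈ ℤ³`. [folklore] -/
def kolFreq : Fin 3 → ℤ := ![0, 0, 1]

/-- The force modes `{e₃, -e₃}`. [folklore] -/
def kolModes : Finset (Fin 3 → ℤ) := {kolFreq, -kolFreq}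

/-- The modes `{0, e₃, -e₃}` carrying a drifted state (the zero mode carries the drift).
[folklore] -/
def kolModes₀ : Finset (Fin 3 → ℤ) := insert 0 kolModes

/-- Membership in `{e₃, -e₃}`. [folklore] -/
theorem mem_kolModes_iff {k : Fin 3 → ℤ} : k ∈ kolModes ↔ k = kolFreq ∨ k = -kolFreq := by
  simp [kolModes]

/-- `e₃ ∈ {e₃, -e₃}`. [folklore] -/
theorem kolFreq_mem : kolFreq ∈ kolModes := mem_kolModes_iff.2 (Or.inl rfl)
/-- `-e₃ ∈ {e₃, -e₃}`. [folklore] -/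
theorem neg_kolFreq_mem : -kolFreq ∈ kolModes := mem_kolModes_iff.2 (Or.inr rfl)

/-- `0 ∉ {e₃, -e₃}`. [folklore] -/
theorem zero_not_mem_kolModes : (0 : Fin 3 → ℤ) ∉ kolModes := fun h => by
  rcases mem_kolModes_iff.1 h with h | h <;> simpa [kolFreq] using congrFun h 2

/-- Sums over the force modes `{e₃, -e₃}`. [folklore] -/
theorem sum_kolModes {M : Type*} [AddCommMonoid M] (g : (Fin 3 → ℤ) → M) :
    ∑ k ∈ kolModes, g k = g kolFreq + g (-kolFreq) :=
  Finset.sum_pair fun h => by simpa [kolFreq] using congrFun h 2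

/-- Force modes are non-zero. [folklore] -/
theorem ne_zero_of_mem_kolModes {k : Fin 3 → ℤ} (hk : k ∈ kolModes) : k ≠ 0 :=
  fun h => zero_not_mem_kolModes (h ▸ hk)

/-- `{e₃, -e₃}` is symmetric. [folklore] -/
theorem kolModes_symm : ∀ k ∈ kolModes, -k ∈ kolModes := by
  intro k hk
  rcases mem_kolModes_iff.1 hk with rfl | rfl
  · exact neg_kolFreq_mem
  · rw [neg_neg]; exact kolFreq_mem

/-- `{0, e₃, -e₃}` is symmetric. [folklore] -/
theorem kolModes₀_symm : ∀ k ∈ kolModes₀, -k ∈ kolModes₀ := by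
  intro k hk
  rcases Finset.mem_insert.1 hk with rfl | hk
  · rw [neg_zero]; exact Finset.mem_insert_self _ _
  · exact Finset.mem_insert_of_mem (kolModes_symm k hk)

/-- Force modes have vanishing first component. [folklore] -/
theorem apply_zero_of_mem_kolModes {k : Fin 3 → ℤ} (hk : k ∈ kolModes) : k 0 = 0 := by
  rcases mem_kolModes_iff.1 hk with rfl | rfl <;> simp [kolFreq]

/-- Force modes have vanishing second component. [folklore] -/
theorem apply_one_of_mem_kolModes {k : Fin 3 → ℤ} (hk : k ∈ kolModes) : k 1 = 0 := by
  rcases mem_kolModes_iff.1 hk with rfl | rfl <;> simp [kolFreq]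

/-- Force modes have third component `±1`. [folklore] -/
theorem sq_apply_two_of_mem_kolModes {k : Fin 3 → ℤ} (hk : k ∈ kolModes) :
    ((k 2 : ℤ) : ℝ) ^ 2 = 1 := by
  rcases mem_kolModes_iff.1 hk with rfl | rfl <;> simp [kolFreq]

/-- Modes of a drifted state have vanishing first component. [folklore] -/
theorem apply_zero_of_mem_kolModes₀ {k : Fin 3 → ℤ} (hk : k ∈ kolModes₀) : k 0 = 0 := by
  rcases Finset.mem_insert.1 hk with rfl | hk
  · rfl
  · exact apply_zero_of_mem_kolModes hk

/-- Modes of a drifted state have vanishing second component. [folklore] -/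
theorem apply_one_of_mem_kolModes₀ {k : Fin 3 → ℤ} (hk : k ∈ kolModes₀) : k 1 = 0 := by
  rcases Finset.mem_insert.1 hk with rfl | hk
  · rfl
  · exact apply_one_of_mem_kolModes hk

/-- `|k|² = 1` on `{e₃, -e₃}`. [folklore] -/
theorem freqNormSq_of_mem_kolModes {k : Fin 3 → ℤ} (hk : k ∈ kolModes) : freqNormSq k = 1 := by
  rcases mem_kolModes_iff.1 hk with rfl | rfl
  · simp [freqNormSq, Fin.sum_univ_three, kolFreq]
  · rw [freqNormSq_neg]; simp [freqNormSq, Fin.sum_univ_three, kolFreq]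

/-! ### The Kolmogorov force `cos(2π x₃) e₁` -/

/-- The polarisation `½ e₁ ∈ ℂ³`: `cos(2πx₃) e₁ = Re (e_{e₃} ½e₁) + Re (e_{-e₃} ½e₁)`. [folklore] -/
def kolVec : EuclideanSpace ℂ (Fin 3) :=
  EuclideanSpace.complexify (EuclideanSpace.single 0 (1 / 2 : ℝ) : EuclideanSpace ℝ (Fin 3))

/-- First component of the polarisation vector. [folklore] -/
theorem kolVec_apply_zero : kolVec 0 = ((1 / 2 : ℝ) : ℂ) := by
  simp [kolVec, EuclideanSpace.complexify_apply]

/-- Second component of the polarisation vector. [folklore] -/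
@[simp] theorem kolVec_apply_one : kolVec 1 = 0 := by
  simp [kolVec, EuclideanSpace.complexify_apply]

/-- Third component of the polarisation vector. [folklore] -/
@[simp] theorem kolVec_apply_two : kolVec 2 = 0 := by
  simp [kolVec, EuclideanSpace.complexify_apply]

/-- The polarisation vector is real. [folklore] -/
theorem conjVec_kolVec : EuclideanSpace.conjVec kolVec = kolVec :=
  EuclideanSpace.conjVec_complexify _

/-- `‖½ e₁‖ = ½`. [folklore] -/
theorem norm_kolVec : ‖kolVec‖ = 1 / 2 := by
  rw [kolVec, EuclideanSpace.norm_complexify, PiLp.norm_single, Real.norm_eq_abs]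
  norm_num

/-- Fourier coefficients of the Kolmogorov force: `½ e₁` off the zero mode (only `±e₃` are used),
`0` at the zero mode. [folklore] -/
def kolForceCoeff (k : Fin 3 → ℤ) : EuclideanSpace ℂ (Fin 3) := if k = 0 then 0 else kolVec

/-- No zero mode in the force. [folklore] -/
theorem kolForceCoeff_zero : kolForceCoeff 0 = 0 := if_pos rfl

/-- Off the zero mode the force coefficient is `½ e₁`. [folklore] -/
theorem kolForceCoeff_of_ne_zero {k : Fin 3 → ℤ} (hk : k ≠ 0) : kolForceCoeff k = kolVec :=
  if_neg hk

/-- **The Kolmogorov force** `f(x) = cos(2π x₃) e₁` on the unit torus (Meshalkin–Sinai's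
`sin`-profile up to a translation), as a real trigonometric polynomial on `{e₃, -e₃}`. [folklore] -/
def kolForce : UnitAddTorus (Fin 3) → EuclideanSpace ℝ (Fin 3) :=
  realTrigPoly kolModes kolForceCoeff

/-- The force coefficients are conjugate-symmetric (the force is real). [folklore] -/
theorem isConjSymm_kolForceCoeff : IsConjSymm kolForceCoeff := by
  intro k
  by_cases hk : k = 0
  · subst hk
    rw [neg_zero, kolForceCoeff_zero, EuclideanSpace.conjVec_zero]
  · rw [kolForceCoeff_of_ne_zero (neg_ne_zero.2 hk), kolForceCoeff_of_ne_zero hk, conjVec_kolVec]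

/-- The force coefficients are transversal (`k · f̂(k) = 0`). [folklore] -/
theorem isTransversal_kolForceCoeff : IsTransversal kolModes kolForceCoeff := by
  intro k hk
  rw [kolForceCoeff_of_ne_zero (ne_zero_of_mem_kolModes hk), Fin.sum_univ_three,
    apply_zero_of_mem_kolModes hk, kolVec_apply_one, kolVec_apply_two]
  simp

/-- The Kolmogorov force is smooth. [folklore] -/
theorem isSmooth_kolForce : IsSmooth kolForce := isSmooth_realTrigPoly _ _

/-- The Kolmogorov force is divergence free. [folklore] -/
theorem isDivFree_kolForce : IsDivFree kolForce :=
  isDivFree_realTrigPoly isTransversal_kolForceCoeff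

/-- The Kolmogorov force has zero mean (no zero mode). [folklore] -/
theorem hasZeroMean_kolForce : HasZeroMean kolForce := by
  show ∫ x, EuclideanSpace.realPart (trigPoly kolModes kolForceCoeff x) = 0
  have hI : Integrable (trigPoly kolModes kolForceCoeff) volume :=
    (continuous_trigPoly _ _).integrable_unitAddTorus
  rw [(EuclideanSpace.realPart :
    EuclideanSpace ℂ (Fin 3) →L[ℝ] EuclideanSpace ℝ (Fin 3)).integral_comp_comm hI]
  have h : ∫ x, trigPoly kolModes kolForceCoeff x = 0 := by
    simp_rw [trigPoly_apply]
    have hint : ∀ k ∈ kolModes,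
        Integrable (fun x : UnitAddTorus (Fin 3) => mFourier k x • kolForceCoeff k) volume :=
      fun k _ => ((mFourier k).continuous.smul continuous_const).integrable_unitAddTorus
    rw [integral_finsetSum _ hint]
    refine Finset.sum_eq_zero fun k hk => ?_
    rw [integral_smul_const, integral_mFourier, if_neg (ne_zero_of_mem_kolModes hk), zero_smul]
  rw [h, map_zero]

/-- `‖f‖₂² = ½`. [folklore] -/
theorem integral_norm_sq_kolForce : ∫ x, ‖kolForce x‖ ^ 2 = 1 / 2 := by
  rw [kolForce, integral_norm_sq_realTrigPoly kolModes_symm isConjSymm_kolForceCoeff, sum_kolModes,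
    kolForceCoeff_of_ne_zero (ne_zero_of_mem_kolModes kolFreq_mem),
    kolForceCoeff_of_ne_zero (ne_zero_of_mem_kolModes neg_kolFreq_mem), norm_kolVec]
  norm_num

/-- The Kolmogorov force is not zero. [folklore] -/
theorem kolForce_ne_zero : kolForce ≠ 0 := fun h => by
  have h' := integral_norm_sq_kolForce
  rw [h] at h'
  simp at h'

/-- The Kolmogorov force on the larger mode set `{0, e₃, -e₃}` (its zero coefficient vanishes).
[folklore] -/
theorem kolForce_apply_eq (y : UnitAddTorus (Fin 3)) :
    kolForce y = realTrigPoly kolModes₀ kolForceCoeff y := by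
  rw [kolForce, kolModes₀, realTrigPoly_apply_eq_sum, realTrigPoly_apply_eq_sum,
    Finset.sum_insert zero_not_mem_kolModes, kolForceCoeff_zero, smul_zero, map_zero, zero_add]

/-! ### The drift symbol and the drifted states -/

/-- **The drift symbol** `σ_{ν,c}(k) = 4π²ν + 2πi c k₃`: the Fourier multiplier of `c ∂₃ - νΔ` on
the unit modes `±e₃`. [folklore] -/
def driftSymbol (ν c : ℝ) (k : Fin 3 → ℤ) : ℂ := ⟨4 * Real.pi ^ 2 * ν, 2 * Real.pi * c * (k 2 : ℝ)⟩

/-- Real part of the drift symbol: the viscous rate `4π²ν`. [folklore] -/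
theorem driftSymbol_re (ν c : ℝ) (k : Fin 3 → ℤ) :
    (driftSymbol ν c k).re = 4 * Real.pi ^ 2 * ν := rfl

/-- Imaginary part of the drift symbol: the Doppler shift `2πck₃`. [folklore] -/
theorem driftSymbol_im (ν c : ℝ) (k : Fin 3 → ℤ) :
    (driftSymbol ν c k).im = 2 * Real.pi * c * (k 2 : ℝ) := rfl

/-- The drift symbol in algebraic form. [folklore] -/
theorem driftSymbol_eq (ν c : ℝ) (k : Fin 3 → ℤ) :
    driftSymbol ν c k =
      (4 : ℂ) * (Real.pi : ℂ) ^ 2 * (ν : ℂ) +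
        (c : ℂ) * (2 * Real.pi * Complex.I * ((k 2 : ℤ) : ℂ)) := by
  apply Complex.ext
  · simp [driftSymbol, pow_two]
  · simp [driftSymbol, pow_two]; ring

/-- The drift symbol does not vanish on `±e₃` unless `ν = c = 0` (its real part is `4π²ν`, its
imaginary part `±2πc`). [folklore] -/
theorem driftSymbol_ne_zero {ν c : ℝ} (h : ν ≠ 0 ∨ c ≠ 0) {k : Fin 3 → ℤ} (hk : k ∈ kolModes) :
    driftSymbol ν c k ≠ 0 := by
  intro h0
  rcases h with hν | hc
  · have h' := congrArg Complex.re h0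
    rw [driftSymbol_re, Complex.zero_re] at h'
    have : (0 : ℝ) < 4 * Real.pi ^ 2 := by positivity
    exact hν (by nlinarith)
  · have h' := congrArg Complex.im h0
    rw [driftSymbol_im, Complex.zero_im] at h'
    have h2 := sq_apply_two_of_mem_kolModes hk
    have hk2 : ((k 2 : ℤ) : ℝ) ≠ 0 := fun h0' => by rw [h0'] at h2; norm_num at h2
    exact mul_ne_zero (mul_ne_zero (mul_ne_zero two_ne_zero Real.pi_ne_zero) hc) hk2 h'

/-- `σ(-k) = conj σ(k)` (reality). [folklore] -/
theorem driftSymbol_neg (ν c : ℝ) (k : Fin 3 → ℤ) :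
    driftSymbol ν c (-k) = conj (driftSymbol ν c k) := by
  apply Complex.ext
  · simp [driftSymbol]
  · simp [driftSymbol]

/-- `|σ(k)|² = 16π⁴ν² + 4π²c²` on `±e₃`. [folklore] -/
theorem norm_sq_driftSymbol (ν c : ℝ) {k : Fin 3 → ℤ} (hk : k ∈ kolModes) :
    ‖driftSymbol ν c k‖ ^ 2 = (4 * Real.pi ^ 2 * ν) ^ 2 + (2 * Real.pi * c) ^ 2 := by
  rw [Complex.sq_norm, Complex.normSq_apply, driftSymbol_re, driftSymbol_im]
  have h2 := sq_apply_two_of_mem_kolModes hk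
  calc _ = (4 * Real.pi ^ 2 * ν) ^ 2 + (2 * Real.pi * c) ^ 2 * ((k 2 : ℤ) : ℝ) ^ 2 := by ring
    _ = _ := by rw [h2, mul_one]

/-- **Fourier coefficients of the drifted Kolmogorov state**: the drift `c e₃` at the zero mode,
`σ_{ν,c}(k)⁻¹ ½e₁` at `k ≠ 0` (only `±e₃` are used). [folklore] -/
def driftCoeff (ν c : ℝ) (k : Fin 3 → ℤ) : EuclideanSpace ℂ (Fin 3) :=
  if k = 0 then EuclideanSpace.complexify (EuclideanSpace.single 2 c : EuclideanSpace ℝ (Fin 3))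
  else (driftSymbol ν c k)⁻¹ • kolVec

/-- The zero mode of a drifted state is the drift `c e₃`. [folklore] -/
theorem driftCoeff_zero (ν c : ℝ) :
    driftCoeff ν c 0 =
      EuclideanSpace.complexify (EuclideanSpace.single 2 c : EuclideanSpace ℝ (Fin 3)) :=
  if_pos rfl

/-- Off the zero mode the coefficient is `σ⁻¹ ½e₁`. [folklore] -/
theorem driftCoeff_of_ne_zero (ν c : ℝ) {k : Fin 3 → ℤ} (hk : k ≠ 0) :
    driftCoeff ν c k = (driftSymbol ν c k)⁻¹ • kolVec := if_neg hk

/-- Components of the zero mode. [folklore] -/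
theorem driftCoeff_zero_apply (ν c : ℝ) (i : Fin 3) :
    driftCoeff ν c 0 i = (((EuclideanSpace.single 2 c : EuclideanSpace ℝ (Fin 3)) i : ℝ) : ℂ) := by
  rw [driftCoeff_zero, EuclideanSpace.complexify_apply]

/-- Off the zero mode the third component vanishes. [folklore] -/
theorem driftCoeff_apply_two_of_ne_zero (ν c : ℝ) {k : Fin 3 → ℤ} (hk : k ≠ 0) :
    driftCoeff ν c k 2 = 0 := by
  rw [driftCoeff_of_ne_zero ν c hk, PiLp.smul_apply, kolVec_apply_two, smul_zero]

/-- The coefficients of a drifted state are conjugate-symmetric (the state is real). [folklore] -/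
theorem isConjSymm_driftCoeff (ν c : ℝ) : IsConjSymm (driftCoeff ν c) := by
  intro k
  by_cases hk : k = 0
  · subst hk
    rw [neg_zero, driftCoeff_zero, EuclideanSpace.conjVec_complexify]
  · rw [driftCoeff_of_ne_zero ν c (neg_ne_zero.2 hk), driftCoeff_of_ne_zero ν c hk,
      EuclideanSpace.conjVec_smul, conjVec_kolVec, driftSymbol_neg, map_inv₀]

/-- The coefficients of a drifted state are transversal (divergence free). [folklore] -/
theorem isTransversal_driftCoeff (ν c : ℝ) : IsTransversal kolModes₀ (driftCoeff ν c) := by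
  intro k hk
  rcases Finset.mem_insert.1 hk with rfl | hk
  · simp
  · rw [driftCoeff_of_ne_zero ν c (ne_zero_of_mem_kolModes hk), Fin.sum_univ_three,
      apply_zero_of_mem_kolModes hk]
    simp

/-- `‖a(±e₃)‖² = ¼ / (16π⁴ν² + 4π²c²)`. [folklore] -/
theorem norm_sq_driftCoeff (ν c : ℝ) {k : Fin 3 → ℤ} (hk : k ∈ kolModes) :
    ‖driftCoeff ν c k‖ ^ 2 = (1 / 4) / ((4 * Real.pi ^ 2 * ν) ^ 2 + (2 * Real.pi * c) ^ 2) := by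
  rw [driftCoeff_of_ne_zero ν c (ne_zero_of_mem_kolModes hk), norm_smul, norm_inv, mul_pow, inv_pow,
    norm_sq_driftSymbol ν c hk, norm_kolVec]
  ring

/-- **The drifted Kolmogorov state** `U_{ν,c} = c e₃ + Re Σ_{k=±e₃} e_k σ_{ν,c}(k)⁻¹ ½e₁`, i.e.
`U = c e₃ + (4π²ν cos 2πx₃ + 2πc sin 2πx₃) e₁ / (16π⁴ν² + 4π²c²)`. [folklore] -/
def driftState (ν c : ℝ) : UnitAddTorus (Fin 3) → EuclideanSpace ℝ (Fin 3) :=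
  realTrigPoly kolModes₀ (driftCoeff ν c)

/-- Coefficients of `∂₃ U_{ν,c}`. [folklore] -/
def dzCoeff (ν c : ℝ) (k : Fin 3 → ℤ) : EuclideanSpace ℂ (Fin 3) :=
  (2 * Real.pi * Complex.I * ((k 2 : ℤ) : ℂ)) • driftCoeff ν c k

/-- Coefficients of `Δ U_{ν,c}`. [folklore] -/
def lapCoeff (ν c : ℝ) (k : Fin 3 → ℤ) : EuclideanSpace ℂ (Fin 3) :=
  -(((4 * Real.pi ^ 2 * freqNormSq k : ℝ) : ℂ) • driftCoeff ν c k)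

/-- Drifted states are smooth. [folklore] -/
theorem isSmooth_driftState (ν c : ℝ) : IsSmooth (driftState ν c) := isSmooth_realTrigPoly _ _

/-- Drifted states are divergence free. [folklore] -/
theorem isDivFree_driftState (ν c : ℝ) : IsDivFree (driftState ν c) :=
  isDivFree_realTrigPoly (isTransversal_driftCoeff ν c)

end Summit.AnomalousDissipation.AnomalousDissipation.Theorems

end
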